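import Mathlib.FieldTheory.Separable
import Mathlib.RingTheory.MvPowerSeries.Inverse
import HarnessLib

/-!
# Simple roots lift to `(V - a) · unit` in power series rings (T2c support, chain W4.1, crux `Steer`)

Topic: `Summits/ResolutionOfSingularities/ResolutionOfSingularities/Theorems`. A small Mathlib-only helper for
seam **T2c** (`chart_step`, FC2 at the new centre: res-L0-w41-stub-1's plan F3) of the dictionary behind the
registered stub `stub_core4Dictionary` on `Theses.FrobeniusClosing.Steer` (stmt-ResolutionOfSingularities-16345):
the SEPARABILITY CORE «for `P` separable and a power series `V` whose constant coefficient `a` is a root of `P`,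
`P(V) = (V - a) · unit`», which is how the minimal polynomials of the (separable!) residues `τ̄_m` of the new
coordinates `u_m / x` produce the generators `X_m · unit (mod X_j)` of the maximal ideal of `κ⟦X⟧`.

* `constantCoeff_aeval` — `constantCoeff (aeval V Q) = Q.eval (constantCoeff V)`.
* `aeval_eq_sub_C_mul_of_isRoot` — `κ` a field, `P : κ[X]` with a SIMPLE root `a` (`P a = 0`, `P′ a ≠ 0`),
  `V ∈ κ⟦X_σ⟧` with `V(0) = a` ⇒ `aeval V P = (V - C a) * w` with `w` a unit.
* `aeval_eq_sub_C_mul_of_separable` — tower form: `P : k₀[X]` separable over any commutative ring `k₀` mapping to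
  `κ`, `aeval a P = 0`.

Proof: `P = (X - C a) · Q` (`mul_divByMonic_eq_iff_isRoot`), `P′(a) = Q(a)`, so `Q(a) ≠ 0` and `Q(V)` is a unit
of `κ⟦X⟧` (`MvPowerSeries.isUnit_iff_constantCoeff`). OURS (campaign res-hironaka, rung L, slot W4.1); classical
algebra, [folklore]; no `Theses.*` / `Cruxes.*` import; NOT a statement of the manuscript under review.
-/

set_option linter.dupNamespace false

noncomputable section

open Polynomial

namespace Summit.ResolutionOfSingularities.ResolutionOfSingularities.Theorems.SwitchingDichotomy.SimpleRoot

variable {κ : Type*} [Field κ] {σ : Type*}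

/-- The constant coefficient of `Q(V)` is `Q(V(0))`. [folklore] -/
theorem constantCoeff_aeval (V : MvPowerSeries σ κ) (Q : κ[X]) :
    MvPowerSeries.constantCoeff (aeval V Q) = Q.eval (MvPowerSeries.constantCoeff V) := by
  rw [Polynomial.aeval_def, Polynomial.hom_eval₂]
  have hcomp : (MvPowerSeries.constantCoeff (σ := σ) (R := κ)).comp
      (algebraMap κ (MvPowerSeries σ κ)) = RingHom.id κ := by
    ext c
    simp [MvPowerSeries.algebraMap_apply]
  rw [hcomp]
  rfl

/-- **Simple roots lift.** Let `κ` be a field, `P ∈ κ[X]` and `a ∈ κ` a SIMPLE root of `P` (`P(a) = 0`,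
`P′(a) ≠ 0`). If `V ∈ κ⟦X_σ⟧` has constant coefficient `a`, then `P(V) = (V - a) · w` for a unit `w` of `κ⟦X_σ⟧`
(namely `w = Q(V)` where `P = (X - a) · Q`, `Q(a) = P′(a) ≠ 0`). [folklore] -/
theorem aeval_eq_sub_C_mul_of_isRoot {P : κ[X]} {a : κ} (ha : P.IsRoot a)
    (ha' : ¬ (derivative P).IsRoot a) (V : MvPowerSeries σ κ) (hV : MvPowerSeries.constantCoeff V = a) :
    ∃ w : MvPowerSeries σ κ, IsUnit w ∧ aeval V P = (V - MvPowerSeries.C a) * w := by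
  set Q := P /ₘ (X - C a) with hQ
  have hP : (X - C a) * Q = P := mul_divByMonic_eq_iff_isRoot.mpr ha
  have hQa : Q.eval a ≠ 0 := by
    intro h0
    apply ha'
    have hder : derivative P = Q + (X - C a) * derivative Q := by
      rw [← hP, derivative_mul, derivative_sub, derivative_X, derivative_C, sub_zero, one_mul]
    rw [IsRoot, hder, eval_add, eval_mul, eval_sub, eval_X, eval_C, sub_self, zero_mul, add_zero, h0]
  refine ⟨aeval V Q, ?_, ?_⟩
  · rw [MvPowerSeries.isUnit_iff_constantCoeff, constantCoeff_aeval, hV]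
    exact isUnit_iff_ne_zero.mpr hQa
  · conv_lhs => rw [← hP]
    rw [map_mul, map_sub, aeval_X, aeval_C, MvPowerSeries.algebraMap_apply, Algebra.algebraMap_self,
      RingHom.id_apply]

/-- **Simple roots lift, tower form** (separable polynomials over a subring). Let `k₀ → κ` be commutative
rings with `κ` a field, `P ∈ k₀[X]` SEPARABLE, `a ∈ κ` a root of `P`, and `V ∈ κ⟦X_σ⟧` with constant coefficient
`a`. Then `P(V) = (V - a) · w` for a unit `w` (roots of separable polynomials are simple:
`Separable.aeval_derivative_ne_zero`). [folklore] -/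
theorem aeval_eq_sub_C_mul_of_separable {k₀ : Type*} [CommRing k₀] [Algebra k₀ κ] {P : k₀[X]}
    (hsep : P.Separable) {a : κ} (ha : aeval a P = 0)
    (V : MvPowerSeries σ κ) (hV : MvPowerSeries.constantCoeff V = a) :
    ∃ w : MvPowerSeries σ κ, IsUnit w ∧ aeval V P = (V - MvPowerSeries.C a) * w := by
  have hroot : (P.map (algebraMap k₀ κ)).IsRoot a := by
    rw [IsRoot, eval_map, ← aeval_def, ha]
  have hder : ¬ (derivative (P.map (algebraMap k₀ κ))).IsRoot a := by
    rw [derivative_map, IsRoot, eval_map, ← aeval_def]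
    exact hsep.aeval_derivative_ne_zero ha
  obtain ⟨w, hw, heq⟩ := aeval_eq_sub_C_mul_of_isRoot hroot hder V hV
  refine ⟨w, hw, ?_⟩
  rw [← heq, aeval_map_algebraMap]

end Summit.ResolutionOfSingularities.ResolutionOfSingularities.Theorems.SwitchingDichotomy.SimpleRoot

end
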